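import Summits.RiemannHypothesis.RiemannHypothesis.Theorems.SignConeSignConeOscillatoryDensityDilation
import Summits.RiemannHypothesis.RiemannHypothesis.Theorems.SignConeSignConeOscillatoryDensityEnergy

/-!
# Crux `SignCone.SignConeOscillatory` (stmt-RiemannHypothesis-16302), line `dual_witness` — density in energy, IV:
# smooth window tests approximate an `L²` window function in `L²` AND in archimedean energy

Assembly of parts I–III.  **Density-in-energy lemma** (`exists_test_seq_of_finite_energy`): for `a > 0` and
`u ∈ L²` with `supp u ⊆ [-a, a]` whose autocorrelation has integrable archimedean integrand (finite log-weighted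
energy), there are Weil tests `Gⱼ` with `tsupport Gⱼ ⊆ [-a, a]`, `∫ |Gⱼ - u|² → 0`, `∫ |Gⱼ|² → ∫ |u|²` and
`reWar (Gⱼ ⋆ G̃ⱼ) → reWar (u ⋆ ũ)`.  Construction: `Gⱼ = (weilDilate ηⱼ u) ⋆ φ_{kⱼ}` with `ηⱼ = 1/(j+2)` and `kⱼ`
so large that the mollifier radius fits in the margin `a ηⱼ/(1+ηⱼ)` freed by the dilation and the mollification
error is `≤ 1/(j+1)`; the polar terms pass to the limit by dominated convergence on `[-2a, 2a]`
(`tendsto_weilMellin_autocorr_of_tendsto`), the energies by part III.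

This is the analytic input that upgrades the KKT split of line `dual_witness` to an EQUIVALENCE
(`…ExtremalNonnegOfCrux.lean`: `SignConeOscillatory → SignConeExtremalNonneg`).
-/

noncomputable section

-- `Summit.RiemannHypothesis.RiemannHypothesis.…` repeats a namespace component by design (D-0017 layout).
set_option linter.dupNamespace false

open scoped BigOperators ComplexConjugate Topology ENNReal
open MeasureTheory Set Filter Complex

namespace Summit.RiemannHypothesis.RiemannHypothesis.Theorems.SignCone.DualWitness

open Literature.NumberTheory.LFunctions Literature.Analysis.SpecialFunctions

variable {a : ℝ} {u : ℝ → ℂ}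

/-! ## Polar terms along an `L²`-convergent sequence of tests with convergent norms -/

/-- `|(G ⋆ G̃)(x)| ≤ ∫ |G|²` for `G ∈ L²`. [folklore] -/
theorem norm_autocorr_le_integral {G : ℝ → ℂ} (hG : MemLp G 2 volume) (x : ℝ) : ‖autocorr G x‖ ≤ ∫ t, ‖G t‖ ^ 2 := by
  have h := norm_autocorr_le hG x
  rw [toReal_eLpNorm_two_eq_sqrt hG, Real.mul_self_sqrt (integral_nonneg fun _ => by positivity)] at h
  exact h

/-- **Polar terms pass to `L²`-limits**: if the tests `Gⱼ` on the window converge to `u` in `L²` with convergent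
`∫ |Gⱼ|²`, then `M_{Gⱼ ⋆ G̃ⱼ}(s) → M_{u ⋆ ũ}(s)` for every `s` (dominated convergence on `[-2a, 2a]`). [folklore] -/
theorem tendsto_weilMellin_autocorr_of_tendsto {G : ℕ → ℝ → ℂ} {N : ℝ}
    (hG : ∀ j, IsWeilTest (G j) ∧ tsupport (G j) ⊆ Icc (-a) a) (hu : MemLp u 2 volume)
    (hlim : Tendsto (fun j => ∫ x, ‖G j x - u x‖ ^ 2) atTop (𝓝 0))
    (hN : Tendsto (fun j => ∫ x, ‖G j x‖ ^ 2) atTop (𝓝 N)) (s : ℂ) :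
    Tendsto (fun j => weilMellin (autocorr (G j)) s) atTop (𝓝 (weilMellin (autocorr u) s)) := by
  have hG2 : ∀ j, MemLp (G j) 2 volume := fun j => (hG j).1.1.continuous.memLp_of_hasCompactSupport (hG j).1.2
  have hGs : ∀ j, Function.support (G j) ⊆ Icc (-a) a := fun j => (subset_tsupport _).trans (hG j).2
  have hcont : ∀ j, Continuous (autocorr (G j)) := fun j => by
    rw [autocorr_eq_weilConv]; exact ((hG j).1.weilConv (hG j).1.weilReflect).1.continuous
  have hker : Continuous fun x : ℝ => cexp ((s - 1 / 2) * x) := by fun_prop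
  set C : ℝ := N + 1 with hC
  have hevC : ∀ᶠ j in atTop, ∫ x, ‖G j x‖ ^ 2 ≤ C := by
    have := (tendsto_order.1 hN).2 C (by rw [hC]; linarith)
    exact this.mono fun j hj => hj.le
  set B : ℝ := C * Real.exp (‖s - 1 / 2‖ * (2 * a)) with hB
  unfold weilMellin
  refine tendsto_integral_filter_of_dominated_convergence (fun x => (Icc (-(2 * a)) (2 * a)).indicator (fun _ => B) x)
    (Eventually.of_forall fun j => ((hcont j).mul hker).aestronglyMeasurable) ?_ ?_ ?_
  · filter_upwards [hevC] with j hj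
    refine Eventually.of_forall fun x => ?_
    by_cases hx : x ∈ Icc (-(2 * a)) (2 * a)
    · rw [indicator_of_mem hx, norm_mul, Complex.norm_exp]
      have hexp : Real.exp ((s - 1 / 2) * (x : ℂ)).re ≤ Real.exp (‖s - 1 / 2‖ * (2 * a)) := by
        refine Real.exp_le_exp.mpr ?_
        calc ((s - 1 / 2) * (x : ℂ)).re ≤ ‖(s - 1 / 2) * (x : ℂ)‖ := re_le_norm _
          _ = ‖s - 1 / 2‖ * |x| := by rw [norm_mul, norm_real, Real.norm_eq_abs]
          _ ≤ ‖s - 1 / 2‖ * (2 * a) := mul_le_mul_of_nonneg_left (abs_le.mpr ⟨hx.1, hx.2⟩) (norm_nonneg _)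
      have hC0 : 0 ≤ C := le_trans (integral_nonneg fun _ => by positivity) hj
      calc ‖autocorr (G j) x‖ * Real.exp ((s - 1 / 2) * (x : ℂ)).re ≤ C * Real.exp (‖s - 1 / 2‖ * (2 * a)) :=
            mul_le_mul ((norm_autocorr_le_integral (hG2 j) x).trans hj) hexp (Real.exp_nonneg _) hC0
        _ = B := rfl
    · have hx' : 2 * a < |x| := by
        rcases not_and_or.mp (fun h => hx ⟨h.1, h.2⟩) with h | h
        · have := not_le.mp h; rw [lt_abs]; right; linarith
        · have := not_le.mp h; rw [lt_abs]; left; linarith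
      rw [indicator_of_notMem hx, autocorr_eq_zero_of_lt (hGs j) hx', zero_mul, norm_zero]
  · exact (integrableOn_const measure_Icc_lt_top.ne).integrable_indicator measurableSet_Icc
  · exact Eventually.of_forall fun x => (tendsto_autocorr hG2 hu hlim x).mul tendsto_const_nhds

/-! ## Norms along an `L²`-convergent sequence -/

/-- If `∫ |Gⱼ - u|² → 0` then `∫ |Gⱼ|² → ∫ |u|²`. [folklore] -/
theorem tendsto_integral_norm_sq_of_tendsto {G : ℕ → ℝ → ℂ} (hG2 : ∀ j, MemLp (G j) 2 volume)
    (hu : MemLp u 2 volume) (hlim : Tendsto (fun j => ∫ x, ‖G j x - u x‖ ^ 2) atTop (𝓝 0)) :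
    Tendsto (fun j => ∫ x, ‖G j x‖ ^ 2) atTop (𝓝 (∫ x, ‖u x‖ ^ 2)) := by
  -- `|√∫|Gⱼ|² - √∫|u|²| ≤ √∫|Gⱼ - u|² → 0`, then square
  set r : ℕ → ℝ := fun j => Real.sqrt (∫ x, ‖G j x‖ ^ 2) with hr
  set ru : ℝ := Real.sqrt (∫ x, ‖u x‖ ^ 2) with hru
  have hkey : ∀ j, |r j - ru| ≤ Real.sqrt (∫ x, ‖G j x - u x‖ ^ 2) := by
    intro j
    have hB : r j ≤ Real.sqrt (∫ x, ‖G j x - u x‖ ^ 2) + ru := by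
      have := sqrt_integral_norm_sq_sub_le ((hG2 j).sub hu) hu.neg
      have e' : (fun t => ‖(G j - u) t - (-u) t‖ ^ 2) = fun t => ‖G j t‖ ^ 2 := by funext t; simp
      rw [e'] at this
      simpa [norm_neg] using this
    have hC : ru ≤ Real.sqrt (∫ x, ‖G j x - u x‖ ^ 2) + r j := by
      have := sqrt_integral_norm_sq_sub_le (hu.sub (hG2 j)) (hG2 j).neg
      have e' : (fun t => ‖(u - G j) t - (-G j) t‖ ^ 2) = fun t => ‖u t‖ ^ 2 := by funext t; simp
      rw [e'] at this
      have hsym : Real.sqrt (∫ t, ‖(u - G j) t‖ ^ 2) = Real.sqrt (∫ x, ‖G j x - u x‖ ^ 2) := by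
        congr 1; refine integral_congr_ae (Eventually.of_forall fun t => ?_); simp [norm_sub_rev]
      rw [hsym] at this
      simpa [norm_neg] using this
    rw [abs_le]; constructor <;> linarith
  have hsqrt : Tendsto (fun j => Real.sqrt (∫ x, ‖G j x - u x‖ ^ 2)) atTop (𝓝 0) := by
    have h := (Real.continuous_sqrt.tendsto 0).comp hlim
    rw [Real.sqrt_zero] at h; exact h
  have hr_lim : Tendsto r atTop (𝓝 ru) := by
    rw [tendsto_iff_norm_sub_tendsto_zero]
    exact squeeze_zero (fun j => norm_nonneg _) (fun j => by rw [Real.norm_eq_abs]; exact hkey j) hsqrt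
  have e1 : ∀ j, ∫ x, ‖G j x‖ ^ 2 = r j ^ 2 := fun j => by
    rw [hr, Real.sq_sqrt (integral_nonneg fun _ => by positivity)]
  have e2 : ∫ x, ‖u x‖ ^ 2 = ru ^ 2 := by rw [hru, Real.sq_sqrt (integral_nonneg fun _ => by positivity)]
  simp_rw [e1, e2]
  exact hr_lim.pow 2

/-! ## The density-in-energy lemma -/

/-- **Density in energy.**  For `a > 0` and `u ∈ L²` with `supp u ⊆ [-a, a]` and integrable archimedean integrand
of `u ⋆ ũ`, there are Weil tests `Gⱼ` on `[-a, a]` with `∫ |Gⱼ - u|² → 0`, `∫ |Gⱼ|² → ∫ |u|²` and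
`reWar (Gⱼ ⋆ G̃ⱼ) → reWar (u ⋆ ũ)`. [folklore] -/
theorem exists_test_seq_of_finite_energy (ha : 0 < a) (hu : MemLp u 2 volume)
    (hsu : Function.support u ⊆ Icc (-a) a) (hE : Integrable (archIntegrand (autocorr u)) volume) :
    ∃ G : ℕ → ℝ → ℂ, (∀ j, IsWeilTest (G j) ∧ tsupport (G j) ⊆ Icc (-a) a) ∧
      Tendsto (fun j => ∫ x, ‖G j x - u x‖ ^ 2) atTop (𝓝 0) ∧
      Tendsto (fun j => ∫ x, ‖G j x‖ ^ 2) atTop (𝓝 (∫ x, ‖u x‖ ^ 2)) ∧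
      Tendsto (fun j => reWar (autocorr (G j))) atTop (𝓝 (reWar (autocorr u))) := by
  have hui : Integrable u := integrable_of_memLp_two_of_support hu hsu
  -- the energy hypothesis in real form, and Plancherel integrability
  have hEr : Integrable fun t : ℝ => ‖weilMellin u (1 / 2 + t * I)‖ ^ 2 * reDigammaQuarter t := by
    have e : archIntegrand (autocorr u) =
        fun t : ℝ => ((‖weilMellin u (1 / 2 + t * I)‖ ^ 2 * reDigammaQuarter t : ℝ) : ℂ) := by
      funext t
      simp only [archIntegrand, mellinShift_eq_weilMellin]
      rw [weilMellin_autocorr_half hui t]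
      unfold reDigammaQuarter
      push_cast; ring
    rw [e] at hE
    exact (hE.re).congr (Eventually.of_forall fun t => by simp only [RCLike.re_to_complex, Complex.ofReal_re])
  have hU : Integrable fun t : ℝ => ‖weilMellin u (1 / 2 + t * I)‖ ^ 2 := dens_integrable_norm_sq_weilMellin_half hui hu
  -- dilation parameters `ηⱼ = 1/(j+2)`
  set η : ℕ → ℝ := fun j => 1 / ((j : ℝ) + 2) with hη
  have hη0 : ∀ j, 0 < η j := fun j => by simp only [hη]; positivity
  have hη1 : ∀ j, η j ≤ 1 := fun j => by
    simp only [hη]; rw [div_le_one (by positivity)]; linarith [(Nat.cast_nonneg j : (0 : ℝ) ≤ j)]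
  have hηlim : Tendsto η atTop (𝓝 0) := by
    have h := (tendsto_one_div_add_atTop_nhds_zero_nat (𝕜 := ℝ)).comp (tendsto_add_atTop_nat 1)
    refine h.congr fun j => ?_
    simp only [hη, Function.comp_apply]; push_cast; ring_nf
  have hηpos : Tendsto η atTop (𝓝[>] 0) :=
    tendsto_nhdsWithin_iff.2 ⟨hηlim, Eventually.of_forall fun j => hη0 j⟩
  -- the dilates
  set v : ℕ → ℝ → ℂ := fun j => weilDilate (η j) u with hv
  have hv2 : ∀ j, MemLp (v j) 2 volume := fun j => memLp_weilDilate hu (by linarith [hη0 j])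
  have hvs : ∀ j, Function.support (v j) ⊆ Icc (-(a / (1 + η j))) (a / (1 + η j)) := fun j =>
    support_weilDilate_subset hsu (hη0 j).le
  -- choice of the mollifier index `kⱼ`
  have hchoice : ∀ j : ℕ, ∃ K : ℕ, j ≤ K ∧ (WeilContinuous.bump K).rOut ≤ a * η j / (1 + η j) ∧
      ∫ x, ‖weilConv (v j) (WeilContinuous.moll K) x - v j x‖ ^ 2 ≤ 1 / ((j : ℝ) + 1) := by
    intro j
    have hmargin : 0 < a * η j / (1 + η j) := by have := hη0 j; positivity
    have h1 : ∀ᶠ K in atTop, (WeilContinuous.bump K).rOut ≤ a * η j / (1 + η j) :=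
      ((tendsto_order.1 WeilContinuous.tendsto_bump_rOut).2 _ hmargin).mono fun K hK => hK.le
    have h2 : ∀ᶠ K in atTop, ∫ x, ‖weilConv (v j) (WeilContinuous.moll K) x - v j x‖ ^ 2 ≤ 1 / ((j : ℝ) + 1) :=
      ((tendsto_order.1 (tendsto_integral_norm_sq_weilConv_moll_sub (hv2 j) (hvs j))).2 _ (by positivity)).mono
        fun K hK => hK.le
    obtain ⟨K, hK⟩ := ((eventually_ge_atTop j).and (h1.and h2)).exists
    exact ⟨K, hK.1, hK.2.1, hK.2.2⟩
  choose k hkj hkr hkL using hchoice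
  have hkr0 : Tendsto (fun j => (WeilContinuous.bump (k j)).rOut) atTop (𝓝 0) := by
    have hle : ∀ j, (WeilContinuous.bump (k j)).rOut ≤ 1 / ((j : ℝ) + 1) := fun j => by
      rw [WeilContinuous.bump_rOut]
      exact one_div_le_one_div_of_le (by positivity) (by exact_mod_cast Nat.add_le_add_right (hkj j) 1)
    exact squeeze_zero (fun j => (WeilContinuous.bump (k j)).rOut_pos.le) hle tendsto_one_div_add_atTop_nhds_zero_nat
  -- the approximants
  set G : ℕ → ℝ → ℂ := fun j => weilConv (v j) (WeilContinuous.moll (k j)) with hGdef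
  have hGtest : ∀ j, IsWeilTest (G j) := fun j => isWeilTest_weilConv_moll_of_memLp (hv2 j) (hvs j) (k j)
  have hGsupp : ∀ j, tsupport (G j) ⊆ Icc (-a) a := fun j => by
    refine tsupport_weilConv_moll_subset_of_le (hvs j) ?_
    have hc : 0 < 1 + η j := by linarith [hη0 j]
    have e : a / (1 + η j) + a * η j / (1 + η j) = a := by field_simp
    linarith [hkr j]
  have hG2 : ∀ j, MemLp (G j) 2 volume := fun j => (hGtest j).1.continuous.memLp_of_hasCompactSupport (hGtest j).2
  -- `L²` convergence
  have hGL2 : Tendsto (fun j => ∫ x, ‖G j x - u x‖ ^ 2) atTop (𝓝 0) := by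
    have hdil : Tendsto (fun j => ∫ x, ‖v j x - u x‖ ^ 2) atTop (𝓝 0) :=
      (tendsto_integral_norm_sq_weilDilate_sub hu).comp hηpos
    have hbd : ∀ j, ∫ x, ‖G j x - u x‖ ^ 2 ≤ 2 * (1 / ((j : ℝ) + 1)) + 2 * ∫ x, ‖v j x - u x‖ ^ 2 := by
      intro j
      have hA : Integrable fun x => ‖G j x - v j x‖ ^ 2 := integrable_norm_sq_of_memLp ((hG2 j).sub (hv2 j))
      have hB : Integrable fun x => ‖v j x - u x‖ ^ 2 := integrable_norm_sq_of_memLp ((hv2 j).sub hu)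
      have hpt : ∀ x, ‖G j x - u x‖ ^ 2 ≤ 2 * ‖G j x - v j x‖ ^ 2 + 2 * ‖v j x - u x‖ ^ 2 := by
        intro x
        have e : G j x - u x = (G j x - v j x) + (v j x - u x) := by ring
        rw [e]
        have h := norm_add_le (G j x - v j x) (v j x - u x)
        nlinarith [sq_nonneg (‖G j x - v j x‖ - ‖v j x - u x‖), norm_nonneg (G j x - v j x + (v j x - u x)),
          norm_nonneg (G j x - v j x), norm_nonneg (v j x - u x)]
      calc ∫ x, ‖G j x - u x‖ ^ 2 ≤ ∫ x, 2 * ‖G j x - v j x‖ ^ 2 + 2 * ‖v j x - u x‖ ^ 2 :=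
            integral_mono (integrable_norm_sq_of_memLp ((hG2 j).sub hu)) ((hA.const_mul 2).add (hB.const_mul 2)) hpt
        _ = 2 * (∫ x, ‖G j x - v j x‖ ^ 2) + 2 * ∫ x, ‖v j x - u x‖ ^ 2 := by
            rw [integral_add (hA.const_mul 2) (hB.const_mul 2), integral_const_mul, integral_const_mul]
        _ ≤ 2 * (1 / ((j : ℝ) + 1)) + 2 * ∫ x, ‖v j x - u x‖ ^ 2 := by linarith [hkL j]
    have hlim0 : Tendsto (fun j : ℕ => 2 * (1 / ((j : ℝ) + 1)) + 2 * ∫ x, ‖v j x - u x‖ ^ 2) atTop (𝓝 0) := by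
      have := (tendsto_one_div_add_atTop_nhds_zero_nat (𝕜 := ℝ)).const_mul 2 |>.add (hdil.const_mul 2)
      simpa using this
    exact squeeze_zero (fun j => integral_nonneg fun _ => by positivity) hbd hlim0
  have hN := tendsto_integral_norm_sq_of_tendsto hG2 hu hGL2
  -- energies
  have hGE := tendsto_energy_approx hui hU hEr hη0 hη1 hηlim hkr0
  -- polar terms
  have hpol : ∀ s : ℂ, Tendsto (fun j => weilMellin (autocorr (G j)) s) atTop (𝓝 (weilMellin (autocorr u) s)) :=
    fun s => tendsto_weilMellin_autocorr_of_tendsto (fun j => ⟨hGtest j, hGsupp j⟩) hu hGL2 hN s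
  refine ⟨G, fun j => ⟨hGtest j, hGsupp j⟩, hGL2, hN, ?_⟩
  -- `reWar` decomposed
  have hdec : ∀ j, reWar (autocorr (G j)) = (weilMellin (autocorr (G j)) 0 + weilMellin (autocorr (G j)) 1).re +
      1 / (2 * Real.pi) * (∫ t : ℝ, ‖weilMellin (G j) (1 / 2 + t * I)‖ ^ 2 * reDigammaQuarter t) -
      (∫ x, ‖G j x‖ ^ 2) * Real.log Real.pi := fun j => by
    rw [reWar_autocorr_eq ((hGtest j).1.continuous.integrable_of_hasCompactSupport (hGtest j).2), autocorr_zero_re]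
  have hdecu : reWar (autocorr u) = (weilMellin (autocorr u) 0 + weilMellin (autocorr u) 1).re +
      1 / (2 * Real.pi) * (∫ t : ℝ, ‖weilMellin u (1 / 2 + t * I)‖ ^ 2 * reDigammaQuarter t) -
      (∫ x, ‖u x‖ ^ 2) * Real.log Real.pi := by
    rw [reWar_autocorr_eq hui, autocorr_zero_re]
  simp_rw [hdec]
  rw [hdecu]
  refine ((((continuous_re.tendsto _).comp ((hpol 0).add (hpol 1))).add (hGE.const_mul _)).sub (hN.mul_const _)).congr
    fun j => ?_
  rfl

/-- **Density in energy** (registered sub-goal of the crux item; `∀`-form of `exists_test_seq_of_finite_energy`). [folklore] -/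
theorem exists_test_seq_tendsto_reWar : ∀ {a : ℝ} {u : ℝ → ℂ}, 0 < a → MemLp u 2 volume → Function.support u ⊆ Icc (-a) a → Integrable (archIntegrand (autocorr u)) volume → ∃ G : ℕ → ℝ → ℂ, (∀ j, IsWeilTest (G j) ∧ tsupport (G j) ⊆ Icc (-a) a) ∧ Tendsto (fun j => ∫ x, ‖G j x - u x‖ ^ 2) atTop (𝓝 0) ∧ Tendsto (fun j => ∫ x, ‖G j x‖ ^ 2) atTop (𝓝 (∫ x, ‖u x‖ ^ 2)) ∧ Tendsto (fun j => reWar (autocorr (G j))) atTop (𝓝 (reWar (autocorr u))) :=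
  fun ha hu hsu hE => exists_test_seq_of_finite_energy ha hu hsu hE

end Summit.RiemannHypothesis.RiemannHypothesis.Theorems.SignCone.DualWitness

end
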